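/-
Copyright: cell pub-balaban-gaps (YM BLITZ Y1, track G1), seat g1-p2 GEN 7 (unit `pub-balaban-gaps-g1-p2`).  Row (D4) NODE O,
OBJECT level: the CONTOUR WINDOW — block-contour transporters `U(Γ) = U_{b₁}U_{b₂}⋯U_{bₙ}` as ordered products of bond transporters:
fibre row sums of `U(Γ) − 1` at most `(1 + δ)ⁿ − 1 ≤ e^{nδ} − 1` from the bond letter `δ` (rows of `U_b − 1`), inverses as reversed
products, holomorphy; with `δ = ηα₀` (61's exponential window) and `n ≤ N`, `Nη ≤ ℓ` (contours inside a unit cube: `N ≤ dL^K`, `L^Kη = 1`)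
the contour letter `α_g = e^{ℓα₀} − 1` (used by `D4WalkBlockCovariantBlockAveraging`) is UNIFORM IN `K`.  (Pure fibre algebra:
imports only `D4WalkBlockTransportAlgebra`.)  HONEST FRAMING: the contour system
`Γ : Site → List bond` is data (any system of in-block contours of length `≤ dL^K` — print's (3.8) fixes one); (D4) instance 0∕1; NOT
BetaPertH, NOT continuum, NOT Clay.
-/
import Summits.QuantumFields.BalabanUV.Gaps.D4WalkBlockTransportAlgebra

/-!
# `Gaps.D4WalkBlockContourWindow` — contour transporters as ordered bond products: window, inverse, holomorphy
# (cell pub-balaban-gaps, seat g1-p2 gen 7)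

HONEST DEPENDENCY (cell pub-balaban, verbatim): continuum YM on T⁴ ⇐ BetaPertH ∧ nine spine estimates (0/9 proved);
BetaPertH ⇐ (D1) ∧ (D4) ∧ CAP+tail.

* §1 `rowSum_mul_le'`, **`rowSum_listProd_sub_one_le`** (`Σ_b|(ΠU_k − 1)_{cb}| ≤ (1 + δ)^{n} − 1`), `one_add_pow_sub_one_le_exp`
  (`(1 + δ)ⁿ − 1 ≤ e^{nδ} − 1`), `listProd_mul_reverse_inv` (`(ΠU_k)(ΠʳU_k⁻¹) = 1`), `differentiableOn_listProd_entry`.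
* §2 **`contourLetter_uniform`**: bond letter `δ = ηα₀`, contour lengths `≤ N` with `Nη ≤ ℓ` ⟹ contour letter `e^{ℓα₀} − 1`, free of `K`.
References: T. Bałaban, Comm. Math. Phys. **99** (1985) 389–434 [B9], (3.8) p.392, (3.37) p.396.
-/

noncomputable section

namespace Summit.QuantumFields.BalabanUV.Gaps.D4WalkBlockContourWindow

open Metric Set Finset

variable {F : Type} [Fintype F] [DecidableEq F]

/-! ## §1. Ordered products of bond transporters -/

omit [DecidableEq F] in
/-- Row sums of a product: `Σ_b|(AB)_{cb}| ≤ (Σ_e|A_{ce}|)·β` when every row sum of `B` is `≤ β`. -/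
theorem rowSum_mul_le' (A B : Matrix F F ℂ) {β : ℝ} (hB : ∀ e, ∑ b, ‖B e b‖ ≤ β) (c : F) :
    ∑ b, ‖(A * B) c b‖ ≤ (∑ e, ‖A c e‖) * β := by
  calc ∑ b, ‖(A * B) c b‖ ≤ ∑ b, ∑ e, ‖A c e‖ * ‖B e b‖ := Finset.sum_le_sum fun b _ => by
          rw [Matrix.mul_apply]; exact (norm_sum_le _ _).trans (Finset.sum_le_sum fun e _ => norm_mul_le _ _)
    _ = ∑ e, ‖A c e‖ * ∑ b, ‖B e b‖ := by rw [Finset.sum_comm]; simp only [Finset.mul_sum]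
    _ ≤ ∑ e, ‖A c e‖ * β := Finset.sum_le_sum fun e _ => mul_le_mul_of_nonneg_left (hB e) (norm_nonneg _)
    _ = (∑ e, ‖A c e‖) * β := by rw [Finset.sum_mul]

/-- Row sums of the identity matrix are `1` (nonempty fibre) — in general `≤ 1`. -/
theorem rowSum_one_le (c : F) : ∑ b, ‖(1 : Matrix F F ℂ) c b‖ ≤ 1 := by
  rw [Finset.sum_eq_single c (fun b _ hb => by rw [Matrix.one_apply_ne (Ne.symm hb), norm_zero])
    (fun h => (h (Finset.mem_univ c)).elim), Matrix.one_apply_eq, norm_one]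

/-- **CONTOUR WINDOW FROM THE BOND LETTER.**  If every factor satisfies `Σ_b|(U_k − 1)_{cb}| ≤ δ` then the ordered product satisfies
`Σ_b|(U_1⋯U_n − 1)_{cb}| ≤ (1 + δ)ⁿ − 1`. [cite: Balaban1985BackgroundPropagators, (3.8) p.392, (3.37) p.396] -/
theorem rowSum_listProd_sub_one_le {δ : ℝ} (hδ : 0 ≤ δ) :
    ∀ (l : List (Matrix F F ℂ)), (∀ U ∈ l, ∀ c, ∑ b, ‖(U - 1) c b‖ ≤ δ) →
      ∀ c, ∑ b, ‖(l.prod - 1) c b‖ ≤ (1 + δ) ^ l.length - 1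
  | [], _, c => by simp
  | U :: l, h, c => by
      have hU : ∀ c, ∑ b, ‖(U - 1) c b‖ ≤ δ := h U (by simp)
      have hl := rowSum_listProd_sub_one_le hδ l (fun V hV => h V (by simp [hV]))
      have hprod : ∀ e, ∑ b, ‖l.prod e b‖ ≤ (1 + δ) ^ l.length := fun e => by
        have h1 := hl e
        calc ∑ b, ‖l.prod e b‖ = ∑ b, ‖((l.prod - 1) + 1) e b‖ := by rw [sub_add_cancel]
          _ ≤ ∑ b, (‖(l.prod - 1) e b‖ + ‖(1 : Matrix F F ℂ) e b‖) := Finset.sum_le_sum fun b _ => by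
              rw [Matrix.add_apply]; exact norm_add_le _ _
          _ ≤ ((1 + δ) ^ l.length - 1) + 1 := by
              rw [Finset.sum_add_distrib]; exact add_le_add h1 (rowSum_one_le e)
          _ = (1 + δ) ^ l.length := by ring
      rw [List.prod_cons, List.length_cons]
      have e : U * l.prod - 1 = (U - 1) * l.prod + (l.prod - 1) := by noncomm_ring
      rw [e]
      calc ∑ b, ‖((U - 1) * l.prod + (l.prod - 1)) c b‖
          ≤ ∑ b, (‖((U - 1) * l.prod) c b‖ + ‖(l.prod - 1) c b‖) := Finset.sum_le_sum fun b _ => by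
            rw [Matrix.add_apply]; exact norm_add_le _ _
        _ ≤ δ * (1 + δ) ^ l.length + ((1 + δ) ^ l.length - 1) := by
            rw [Finset.sum_add_distrib]
            refine add_le_add ((rowSum_mul_le' _ _ hprod c).trans ?_) (hl c)
            exact mul_le_mul_of_nonneg_right (hU c) (by positivity)
        _ = (1 + δ) ^ (l.length + 1) - 1 := by ring

/-- `(1 + δ)ⁿ − 1 ≤ e^{nδ} − 1` for `0 ≤ δ`. -/
theorem one_add_pow_sub_one_le_exp {δ : ℝ} (hδ : 0 ≤ δ) (n : ℕ) : (1 + δ) ^ n - 1 ≤ Real.exp (n * δ) - 1 := by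
  have h1 : 1 + δ ≤ Real.exp δ := by have := Real.add_one_le_exp δ; linarith
  have h2 : (1 + δ) ^ n ≤ (Real.exp δ) ^ n := pow_le_pow_left₀ (by linarith) h1 n
  rw [← Real.exp_nat_mul] at h2
  linarith

/-- **Inverse of a contour transporter**: `(U_1⋯U_n)(U_n⁻¹⋯U_1⁻¹) = 1` for factorwise right inverses. -/
theorem listProd_mul_reverse_inv :
    ∀ (l : List (Matrix F F ℂ × Matrix F F ℂ)), (∀ q ∈ l, q.1 * q.2 = 1) →
      (l.map Prod.fst).prod * (l.map Prod.snd).reverse.prod = 1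
  | [], _ => by simp
  | q :: l, h => by
      have hq : q.1 * q.2 = 1 := h q (by simp)
      have hl := listProd_mul_reverse_inv l (fun r hr => h r (by simp [hr]))
      rw [List.map_cons, List.map_cons, List.prod_cons, List.reverse_cons, List.prod_append, List.prod_singleton,
        Matrix.mul_assoc, ← Matrix.mul_assoc (l.map Prod.fst).prod, hl, Matrix.one_mul, hq]

/-- Entries of an ordered product of holomorphic matrix families are holomorphic. -/
theorem differentiableOn_listProd_entry {E : Type*} [NormedAddCommGroup E] [NormedSpace ℂ E] {s : Set E} :
    ∀ (l : List (E → Matrix F F ℂ)), (∀ U ∈ l, ∀ c b, DifferentiableOn ℂ (fun u => U u c b) s) →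
      ∀ c b, DifferentiableOn ℂ (fun u => (l.map fun U => U u).prod c b) s
  | [], _, c, b => by simp only [List.map_nil, List.prod_nil]; exact differentiableOn_const _
  | U :: l, h, c, b => by
      have hl := differentiableOn_listProd_entry l (fun V hV => h V (by simp [hV]))
      simp only [List.map_cons, List.prod_cons, Matrix.mul_apply]
      exact DifferentiableOn.fun_sum fun e _ => (h U (by simp) c e).mul (hl e b)

/-! ## §2. The contour letter is uniform in `K` -/

/-- **THE CONTOUR LETTER IS UNIFORM IN `K`.**  Bond letter `δ = ηα₀` (`0 ≤ η`, `0 ≤ α₀`), a contour of `n ≤ N` bonds with `Nη ≤ ℓ`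
(contours inside a unit cube: `N ≤ dL^K` bonds of the `η = L^{−K}`-lattice, `ℓ = d`) ⟹ `Σ_b|(U(Γ) − 1)_{cb}| ≤ e^{ℓα₀} − 1`, free of `K`.
[cite: Balaban1985BackgroundPropagators, (3.8) p.392, (3.37) p.396] -/
theorem contourLetter_uniform {η α₀ ℓ : ℝ} {N : ℕ} (hη : 0 ≤ η) (hα₀ : 0 ≤ α₀) (hN : (N : ℝ) * η ≤ ℓ)
    (l : List (Matrix F F ℂ)) (hl : l.length ≤ N) (h : ∀ U ∈ l, ∀ c, ∑ b, ‖(U - 1) c b‖ ≤ η * α₀) (c : F) :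
    ∑ b, ‖(l.prod - 1) c b‖ ≤ Real.exp (ℓ * α₀) - 1 := by
  have h1 := rowSum_listProd_sub_one_le (mul_nonneg hη hα₀) l h c
  have h2 := one_add_pow_sub_one_le_exp (mul_nonneg hη hα₀) l.length
  have h3 : Real.exp (l.length * (η * α₀)) ≤ Real.exp (ℓ * α₀) := by
    refine Real.exp_le_exp.2 ?_
    have hlen : (l.length : ℝ) ≤ N := by exact_mod_cast hl
    calc (l.length : ℝ) * (η * α₀) = (l.length * η) * α₀ := by ring
      _ ≤ (N * η) * α₀ := mul_le_mul_of_nonneg_right (mul_le_mul_of_nonneg_right hlen hη) hα₀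
      _ ≤ ℓ * α₀ := mul_le_mul_of_nonneg_right hN hα₀
  linarith

end Summit.QuantumFields.BalabanUV.Gaps.D4WalkBlockContourWindow

end
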